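import Summits.Ventures.DiscreteObjects.Hadamard.QRBlocks167
import Literature.Combinatorics.Designs.GoethalsSeidelArray

/-!
# Hadamard 668 census — no `4 × 4` array of sixteen square-invariant circulant blocks of order 167 is Hadamard

Framing: lottery ticket; floor = certified bounds/negative ranges.

Cell pub-namedobj (venture DiscreteObjects), target (H), family F12 §6 (hadamard gen 4).  A Hadamard matrix `H`
of order `668 = 4 · 167` admitting the Frobenius group `ℤ₁₆₇ ⋊ C₈₃` as a group of automorphisms whose element of
order 167 acts fixed-point-freely on rows and on columns is — after re-signing (an odd-order group of signed
permutations can be conjugated to permutations), re-indexing every row- and column-orbit by `ZMod 167` so that the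
element of order 167 is `i ↦ i + 1`, and re-basing each orbit at the fixed point of the element of order 83 (which
then acts as `i ↦ c i` with the same `c` of order 83 on every orbit) — a `4 × 4` array of sixteen CIRCULANT `±1`
blocks of order 167 whose first rows are invariant under the non-zero squares `C₈₃ = ⟨4⟩`.  That reduction is
on paper (pub-namedobj-hadamard-g4/FAMILY-F12.md §6); this file is the kernel certificate of the finite
statement it reduces to: such an array is never Hadamard (`no_circulant16_qr167`).  The Goethals–Seidel,
Williamson, propus, Williamson-type and Ito-type (quasi-Williamson / negaperiodic-Golay) arrays with
square-invariant blocks are all conjugate to special cases, so this single statement contains bound line 1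
(`no_gs_quad_qr167`, which is also its proof: block row `0` of `H Hᵀ = 668 • 1` is exactly a Goethals–Seidel
quadruple condition on the four first rows `x 0 0, …, x 0 3`).

Ours, not literature; no `sorry`, no `native_decide`; axioms `propext`, `Classical.choice`, `Quot.sound`.
-/

open Finset BigOperators Matrix

namespace Summit.Ventures.DiscreteObjects.Hadamard

open Literature.Combinatorics.Designs.LegendrePairs (PAF IsPM)
open Literature.Combinatorics.Designs.GoethalsSeidel (IsHadamardMatrix)

/-! The `4 × 4` array of sixteen circulant blocks with first rows `x p q` (`p, q : Fin 4`) is written inline as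
`Matrix.of fun P Q : Fin 4 × ZMod 167 => x P.1 Q.1 (P.2 - Q.2)` (entry `((p,i),(q,j)) = x p q (i - j)`, Mathlib's
circulant convention), so that this file declares no new definition. -/

/-- the correlation sum of one circulant block along block row `0`: `Σ_j x(0 - j) x(s - j) = PAF_x(s)` -/
lemma sum_shift_eq_paf (y : ZMod 167 → ℤ) (s : ZMod 167) :
    ∑ j : ZMod 167, y (0 - j) * y (s - j) = PAF y s := by
  unfold PAF
  refine Fintype.sum_equiv (Equiv.neg (ZMod 167)) _ _ (fun j => ?_)
  simp only [Equiv.neg_apply, sub_eq_add_neg, zero_add, add_comm s (-j)]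

/-- the `((0,0),(0,s))` entry of `H Hᵀ` for the sixteen-circulant array `H` is the Goethals–Seidel sum of block
row `0` -/
lemma blockCirc_gram_row0 (x : Fin 4 → Fin 4 → ZMod 167 → ℤ) (s : ZMod 167) :
    ((Matrix.of fun P Q : Fin 4 × ZMod 167 => x P.1 Q.1 (P.2 - Q.2)) *
        (Matrix.of fun P Q : Fin 4 × ZMod 167 => x P.1 Q.1 (P.2 - Q.2))ᵀ)
      ((0 : Fin 4), (0 : ZMod 167)) ((0 : Fin 4), s)
      = PAF (x 0 0) s + PAF (x 0 1) s + PAF (x 0 2) s + PAF (x 0 3) s := by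
  rw [Matrix.mul_apply, Fintype.sum_prod_type, Fin.sum_univ_four]
  simp only [Matrix.transpose_apply, Matrix.of_apply, sum_shift_eq_paf]

/-- **Family F12 at `p = 167` (kernel certificate).** No `4 × 4` array of sixteen circulant `±1` blocks of order
167 whose first rows are all invariant under the non-zero squares `C₈₃ = ⟨4⟩ ≤ (ℤ/167)ˣ` is a Hadamard matrix.
Equivalently (paper reduction, FAMILY-F12 §6): no Hadamard matrix of order 668 admits `ℤ₁₆₇ ⋊ C₈₃` as
automorphisms with row- and column-orbits of length 167.  Contains bound line 1 and the square-invariant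
sub-families of the Williamson, propus, Williamson-type and Ito-type (2N / negaperiodic Golay) arrays. -/
theorem no_circulant16_qr167 (x : Fin 4 → Fin 4 → ZMod 167 → ℤ) (hpm : ∀ p q, IsPM (x p q))
    (hinv : ∀ p q, ∀ i : ZMod 167, x p q (4 * i) = x p q i) :
    ¬ IsHadamardMatrix (Matrix.of fun P Q : Fin 4 × ZMod 167 => x P.1 Q.1 (P.2 - Q.2)) := by
  rintro ⟨_, hH⟩
  refine no_gs_quad_qr167 (x 0 0) (x 0 1) (x 0 2) (x 0 3) (hpm 0 0) (hpm 0 1) (hpm 0 2) (hpm 0 3)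
    (hinv 0 0) (hinv 0 1) (hinv 0 2) (hinv 0 3) (fun s hs => ?_)
  have h := congrFun (congrFun hH ((0 : Fin 4), (0 : ZMod 167))) ((0 : Fin 4), s)
  rw [blockCirc_gram_row0, Matrix.smul_apply, Matrix.one_apply_ne] at h
  · simpa using h
  · intro h0
    exact hs (Prod.mk.inj h0).2.symm

end Summit.Ventures.DiscreteObjects.Hadamard
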